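import Summits.BirchSwinnertonDyer.Rank1Residual.Additive.RamifiedSevenGenusUnitSideUpToUnit
import Summits.BirchSwinnertonDyer.BirchSwinnertonDyer.Theorems.PrintCf2RubinValueTwoLeopoldtLimitPins
import HarnessLib

/-!
# `𝒞₇` genus road, crux K1ᵘ: ORBIT CERTIFICATE for the unit letter — the value pin is `Γ_ℚ`-blind, and the identity up to
# a unit of `Λ` MOVES ALONG THE ORBIT (multiplier `× (1+T)` along `γ₀`, `× η₁(δ)` along `δ ∈ Δ`)

Cell bsd-cm, seat bsd-cm-k-ty1 g25 (SUMMON 16c4e918e43e0aee, row GENUS-PORT-A3), companion of `RamifiedSevenGenusUnitSideUpToUnit.lean`,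
answering the critic's (S5) VERDICT (idea-crit-15 g14, bsd-cm INBOX 2026-08-30T18:37:21Z; probe `pub/ideators/idea-crit-15/S5_orbit_g14.lean`
57a0fc5c83d5df02, whose constructions (W1) `isNormedEllipticUnitFamily_galFamily` and (W2) `translateDatum` are RE-DERIVED here and credited).
The critic's mechanism: two instances of the EXACT-constant identity on one `Γ_ℚ`-orbit of `θu` force `Λ`-torsion of `e_{η₁}ξ`.  On the
UNIT letter the same two instances differ by the units `1 + T` (along `γ₀`, pin (T)) and `η₁(δ)` (along the torsion part `Δ`, pin (A) + the
projector relation `e ∘ δ = η₁(δ)·e`), so the transported identity is again an instance of the letter: `unitFactorisationShape_translateDatum`,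
`unitFactorisationShape_translateTorsionDatum`, the family-level forms (§3), and (§4) THE DEAD LETTERS NAMED — the critic's
`not_forall_unitSide`, `not_stub_K1u`, `not_stub_inputs_v13` re-homed with `x_ne_zero`, `scalar_ne_zero` (pen D930 (3)), so no seat re-files the
finite-constant identity.  SCOPE of the certificate: the generators `γ₀^{±1}`-words and `Δ` of
the torsor (the full `(1+T)^{ℤ₇}` needs the completed action and is not typed here; every such move is again a unit of `Λ`).

Theorems and two transport constructions only; NO named fact; kit 0.  HONEST LABEL: nothing closes; K1ᵘ is NOT proved;
stmt-BirchSwinnertonDyer-19945 is OPEN; `X12.CMRamifiedSeven` is NOT proved; BSD is claimed for no curve.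

## References
K. Kato, Astérisque 295 (2004) §15.5–15.6 (pp. 253–254) [Kato2004Asterisque]; T. Tsuji, J. Number Theory 78 (1999) §2 Lemma 2.1, §3
(pp. 3–6) [Tsuji1999]; S. Lang, *Cyclotomic Fields I–II* (1990) Ch. 5 §1, Ch. 10 §2 [Lang1990]; critic probe `S5_orbit_g14.lean`
(idea-crit-15 g14, 57a0fc5c83d5df02).
-/

noncomputable section

open scoped NumberField
open PowerSeries IsDedekindDomain Field
open Literature.NumberTheory.EllipticCurves
open Literature.NumberTheory.EllipticCurves.IwasawaAlgebra
open Literature.NumberTheory.IwasawaTheory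
open Literature.NumberTheory.IwasawaTheory.StickelbergerSeries
open Literature.NumberTheory.ComplexMultiplication.EllipticUnits
open Literature.NumberTheory.NumberFields
open Summit.BirchSwinnertonDyer.BirchSwinnertonDyer.Theorems.PrintCf2.LeopoldtAtV
  (galUnits_mem_globalUnitsOf galTranslate_globalToSemilocalUnits)

namespace Summit.BirchSwinnertonDyer.Rank1Residual.Additive.GenusSeven

/-! ## §1 Galois translates of global families; the value pin is `Γ_ℚ`-blind -/

namespace GenusFrame

variable (F : GenusFrame)

/-- The `σ`-translate `(σ θ_n)_n` of a global family on the genus tower (every layer is normal over `ℚ`).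
Construction of the critic's probe (idea-crit-15 g14), re-derived. [cite: Tsuji1999, §3 (pp. 5–6)] -/
def galFamily (σ : absoluteGaloisGroup ℚ) (θu : ∀ n : ℕ, globalUnitsOf (F.layer n)) :
    ∀ n : ℕ, globalUnitsOf (F.layer n) := fun n =>
  ⟨galUnits σ (θu n : (AlgebraicClosure ℚ)ˣ), @galUnits_mem_globalUnitsOf ℚ _ (F.layer n) (F.normal_layer n) σ (θu n)⟩

/-- Values of the translate. [cite: Tsuji1999, §3 (pp. 5–6)] -/
theorem coe_galFamily (σ : absoluteGaloisGroup ℚ) (θu : ∀ n : ℕ, globalUnitsOf (F.layer n)) (n : ℕ) :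
    (((F.galFamily σ θu n : globalUnitsOf (F.layer n)) : (AlgebraicClosure ℚ)ˣ) : AlgebraicClosure ℚ) =
      σ • (((θu n : globalUnitsOf (F.layer n)) : (AlgebraicClosure ℚ)ˣ) : AlgebraicClosure ℚ) := rfl

/-- Layers are `Γ_ℚ`-stable. [cite: Tsuji1999, §3 (p. 5)] -/
theorem smul_mem_layer_iff (σ : absoluteGaloisGroup ℚ) (n : ℕ) (y : AlgebraicClosure ℚ) :
    σ • y ∈ F.layer n ↔ y ∈ F.layer n :=
  ⟨fun hy => by simpa using CyclotomicUnits.smul_mem_of_normal (F.layer n) (F.normal_layer n) σ⁻¹ hy,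
    fun hy => CyclotomicUnits.smul_mem_of_normal (F.layer n) (F.normal_layer n) σ hy⟩

/-- Pin (T): `rep n ((1+T)•m)` is the `γ₀`-translate of `rep n m`. [cite: Tsuji1999, §3 (p. 6, «T = γ − 1»)] -/
theorem rep_one_add_X_smul (n : ℕ) (m : F.U.M) :
    F.U.rep n ((1 + X : IwasawaAlgebra 7) • m) =
      CyclotomicAction.layerTranslate (v := F.v) F.normal_F₀ n F.γ₀ (F.U.rep n m) := by
  rw [add_smul, one_smul, F.U.rep_add,
    F.U.rep_X_smul n m _ (CyclotomicAction.isGaloisTranslate_layerTranslate F.normal_F₀ n F.γ₀ _),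
    mul_left_comm, mul_inv_cancel, mul_one]

/-- The `σ`-translate of the semi-local image of a global unit is the image of `σ u`. [cite: Tsuji1999, §3 (pp. 5–6)] -/
theorem layerTranslate_globalToSemilocalUnits (σ : absoluteGaloisGroup ℚ) (n : ℕ) (u : globalUnitsOf (F.layer n)) :
    CyclotomicAction.layerTranslate (v := F.v) F.normal_F₀ n σ (globalToSemilocalUnits F.v (F.layer n) u) =
      globalToSemilocalUnits F.v (F.layer n)
        ⟨galUnits σ (u : (AlgebraicClosure ℚ)ˣ), @galUnits_mem_globalUnitsOf ℚ _ (F.layer n) (F.normal_layer n) σ u⟩ :=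
  @galTranslate_globalToSemilocalUnits ℚ _ _ F.v (F.layer n) (F.normal_layer n) σ u

end GenusFrame

section Orbit

variable {F : GenusFrame} {θu : ∀ n : ℕ, globalUnitsOf (F.layer n)}

/-- **THE VALUE PIN IS BLIND TO THE GALOIS ORBIT** (critic idea-crit-15 g14, (W1); re-derived): `σ•θu` is again a «normed
elliptic unit family» — same `K, ι, 𝔣, 𝔞, z`, identification `σ ∘ e`. [cite: Kato2004Asterisque, §15.5 (p. 253)] -/
theorem isNormedEllipticUnitFamily_galFamily (σ : absoluteGaloisGroup ℚ) (h : IsNormedEllipticUnitFamily F θu) :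
    IsNormedEllipticUnitFamily F (F.galFamily σ θu) := by
  obtain ⟨K, _, _, s, ι, e, 𝔣, 𝔞, z, hz, h2, hs, hN𝔣, h𝔣, hTw, hN𝔞, hcov, hprod⟩ := h
  refine ⟨K, _, _, s, ι, (MulSemiringAction.toRingHom (absoluteGaloisGroup ℚ) (AlgebraicClosure ℚ) σ).comp e,
    𝔣, 𝔞, z, hz, h2, hs, hN𝔣, h𝔣, hTw, hN𝔞, ?_, ?_⟩
  · intro n y hy
    obtain ⟨x, hx, hex⟩ := hcov n (σ⁻¹ • y) (CyclotomicUnits.smul_mem_of_normal (F.layer n) (F.normal_layer n) σ⁻¹ hy)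
    exact ⟨x, hx, by simp [hex, smul_inv_smul]⟩
  · intro n
    have hS : {τ : katoLayer 7 𝔣 (n + 1) ≃ₐ[K] katoLayer 7 𝔣 (n + 1) |
        ∀ x : katoLayer 7 𝔣 (n + 1),
          ((MulSemiringAction.toRingHom (absoluteGaloisGroup ℚ) (AlgebraicClosure ℚ) σ).comp e)
            (x : AlgebraicClosure K) ∈ F.layer n → τ x = x} =
      {τ | ∀ x : katoLayer 7 𝔣 (n + 1), e (x : AlgebraicClosure K) ∈ F.layer n → τ x = x} := by
      ext τ
      simp only [Set.mem_setOf_eq, RingHom.comp_apply, MulSemiringAction.toRingHom_apply, F.smul_mem_layer_iff]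
    rw [hS, F.coe_galFamily, hprod n]
    exact MonoidHom.map_finprod_mem _
      (MulSemiringAction.toRingHom (absoluteGaloisGroup ℚ) (AlgebraicClosure ℚ) σ : AlgebraicClosure ℚ →* AlgebraicClosure ℚ)
      (Set.toFinite _)

/-! ## §2 Transport of oriented data along `γ₀` and along `Δ`; the unit letter moves along -/

namespace OrientedGenusDatum

/-- **Transport along `γ₀`** (critic's (W2), re-derived): an oriented datum over `θu` gives one over `γ₀•θu` with
`θraw ↦ (1+T)•θraw`, `θ ↦ (1+T)•θ`, everything else unchanged (pin (T)). [cite: Tsuji1999, §3 (p. 6, «T = γ − 1»)] -/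
def translateDatum (d : OrientedGenusDatum F θu) : OrientedGenusDatum F (F.galFamily F.γ₀ θu) :=
  { d with
    θraw := (1 + X : IwasawaAlgebra 7) • d.θraw
    θraw_rep := fun n => by
      rw [smul_comm, F.rep_one_add_X_smul, d.θraw_rep n]
      exact (map_pow (CyclotomicAction.layerTranslate (v := F.v) F.normal_F₀ n F.γ₀) _ 48).trans
        (congrArg (· ^ 48) (F.layerTranslate_globalToSemilocalUnits F.γ₀ n (θu n)))
    θ := (1 + X : IwasawaAlgebra 7) • d.θ
    θ_eq := by rw [Submodule.coe_smul, d.θ_eq, map_smul] }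

/-- `θ` of the `γ₀`-transported datum. [cite: Tsuji1999, §3 (p. 6)] -/
@[simp] theorem translateDatum_θ (d : OrientedGenusDatum F θu) : d.translateDatum.θ = (1 + X : IwasawaAlgebra 7) • d.θ := rfl
/-- `ξ` is unchanged by the `γ₀`-transport. [cite: Tsuji1999, §3 (p. 6)] -/
@[simp] theorem translateDatum_ξ (d : OrientedGenusDatum F θu) : d.translateDatum.ξ = d.ξ := rfl
/-- `G_𝔞` is unchanged by the `γ₀`-transport. [cite: Kato2004Asterisque, §15.5–15.6 (pp. 253–254)] -/
@[simp] theorem translateDatum_genusFactorM (d : OrientedGenusDatum F θu) : d.translateDatum.genusFactorM = d.genusFactorM := rfl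
/-- `x` is unchanged by the `γ₀`-transport. [cite: Kato2004Asterisque, §15.5 (p. 253)] -/
@[simp] theorem translateDatum_x (d : OrientedGenusDatum F θu) : d.translateDatum.x = d.x := rfl
/-- `Θm` is unchanged by the `γ₀`-transport. [cite: Lang1990, Ch. 10 §2 (PDF p. 171)] -/
@[simp] theorem translateDatum_Θm (d : OrientedGenusDatum F θu) : d.translateDatum.Θm = d.Θm := rfl

/-- `1 + T` is a unit of `Λ = ℤ₇⟦T⟧`. [cite: Lang1990, Ch. 5 §1 (PDF p. 126)] -/
theorem isUnit_one_add_X : IsUnit (1 + X : IwasawaAlgebra 7) := by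
  rw [PowerSeries.isUnit_iff_constantCoeff, map_add, map_one, constantCoeff_X, add_zero]
  exact isUnit_one

/-- **The unit letter moves along `γ₀`**: the multiplier changes by the unit `1 + T`.
[cite: Kato2004Asterisque, §15.5–15.6 (pp. 253–254)] [cite: Tsuji1999, §3 (p. 6)] -/
theorem unitFactorisationShape_translateDatum (d : OrientedGenusDatum F θu) (h : d.UnitFactorisationShape) :
    d.translateDatum.UnitFactorisationShape := by
  obtain ⟨w, hw⟩ := h
  obtain ⟨t, ht⟩ := isUnit_one_add_X
  refine ⟨t * w, ?_⟩
  rw [translateDatum_θ, translateDatum_ξ, translateDatum_genusFactorM, hw, ← mul_smul, ← ht, Units.val_mul, mul_assoc]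

/-- **Transport along `δ ∈ Δ`** (the torsion part of the torsor): `θraw ↦ δ•θraw`, `θ ↦ η₁(δ)•θ` (pin (A) + the projector
relation `e ∘ δ = η₁(δ)·e`), everything else unchanged. [cite: Tsuji1999, §2 Lemma 2.1, §3 (pp. 3–6)] -/
def translateTorsionDatum (δ : torsionCyclotomicSubgroup 7) (d : OrientedGenusDatum F θu) :
    OrientedGenusDatum F (F.galFamily (δ : absoluteGaloisGroup ℚ) θu) :=
  { d with
    θraw := F.U.act δ d.θraw
    θraw_rep := fun n => by
      rw [← map_nsmul, CyclotomicAction.rep_act_eq_layerTranslate F.U F.normal_F₀, d.θraw_rep n]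
      exact (map_pow (CyclotomicAction.layerTranslate (v := F.v) F.normal_F₀ n (δ : absoluteGaloisGroup ℚ)) _ 48).trans
        (congrArg (· ^ 48) (F.layerTranslate_globalToSemilocalUnits δ n (θu n)))
    θ := (C ((F.η₁ δ : ℤ_[7]ˣ) : ℤ_[7]) : IwasawaAlgebra 7) • d.θ
    θ_eq := by rw [Submodule.coe_smul, d.θ_eq, d.e_isChiProjector.2.2] }

/-- `θ` of the `δ`-transported datum. [cite: Tsuji1999, §2 Lemma 2.1 (pp. 3–4)] -/
@[simp] theorem translateTorsionDatum_θ (δ : torsionCyclotomicSubgroup 7) (d : OrientedGenusDatum F θu) :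
    (d.translateTorsionDatum δ).θ = (C ((F.η₁ δ : ℤ_[7]ˣ) : ℤ_[7]) : IwasawaAlgebra 7) • d.θ := rfl
/-- `ξ` is unchanged by the `δ`-transport. [cite: Tsuji1999, §3 (p. 6)] -/
@[simp] theorem translateTorsionDatum_ξ (δ : torsionCyclotomicSubgroup 7) (d : OrientedGenusDatum F θu) :
    (d.translateTorsionDatum δ).ξ = d.ξ := rfl
/-- `G_𝔞` is unchanged by the `δ`-transport. [cite: Kato2004Asterisque, §15.5–15.6 (pp. 253–254)] -/
@[simp] theorem translateTorsionDatum_genusFactorM (δ : torsionCyclotomicSubgroup 7) (d : OrientedGenusDatum F θu) :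
    (d.translateTorsionDatum δ).genusFactorM = d.genusFactorM := rfl

/-- **The unit letter moves along `Δ`**: the multiplier changes by the unit `η₁(δ)`.
[cite: Kato2004Asterisque, §15.5–15.6 (pp. 253–254)] [cite: Tsuji1999, §2 Lemma 2.1 (pp. 3–4)] -/
theorem unitFactorisationShape_translateTorsionDatum (δ : torsionCyclotomicSubgroup 7) (d : OrientedGenusDatum F θu)
    (h : d.UnitFactorisationShape) : (d.translateTorsionDatum δ).UnitFactorisationShape := by
  obtain ⟨w, hw⟩ := h
  obtain ⟨t, ht⟩ := ((F.η₁ δ).isUnit).map (C : ℤ_[7] →+* IwasawaAlgebra 7)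
  refine ⟨t * w, ?_⟩
  rw [translateTorsionDatum_θ, translateTorsionDatum_ξ, translateTorsionDatum_genusFactorM, hw, ← mul_smul, ← ht, Units.val_mul,
    mul_assoc]

end OrientedGenusDatum

/-! ## §3 Family-level forms: the unit-form letters at `θu` imply them at `γ₀•θu` and at `δ•θu` -/

/-- **The unit-form K1ᵘ letter at `(F, θu)` implies it at `(F, γ₀•θu)` and at `(F, δ•θu)`** — the orbit moves of the
critic's witness class produce no contradiction on the unit letter. [cite: Kato2004Asterisque, §15.5–15.6 (pp. 253–254)] -/
theorem exists_unitFactorisation_galFamily_γ₀ (h : ∃ d : OrientedGenusDatum F θu, d.UnitFactorisationShape) :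
    ∃ d : OrientedGenusDatum F (F.galFamily F.γ₀ θu), d.UnitFactorisationShape := by
  obtain ⟨d, hd⟩ := h
  exact ⟨d.translateDatum, d.unitFactorisationShape_translateDatum hd⟩

/-- The same along `δ ∈ Δ`. [cite: Kato2004Asterisque, §15.5–15.6 (pp. 253–254)] -/
theorem exists_unitFactorisation_galFamily_torsion (δ : torsionCyclotomicSubgroup 7)
    (h : ∃ d : OrientedGenusDatum F θu, d.UnitFactorisationShape) :
    ∃ d : OrientedGenusDatum F (F.galFamily (δ : absoluteGaloisGroup ℚ) θu), d.UnitFactorisationShape := by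
  obtain ⟨d, hd⟩ := h
  exact ⟨d.translateTorsionDatum δ, d.unitFactorisationShape_translateTorsionDatum δ hd⟩

/-- **`UnitSideIdentityShapeUpToUnit` along `γ₀`** (given one datum over `θu`; the `∀ d` is handled by determinacy of
`θ`, `ξ`, `x`, `Θm`). [cite: Kato2004Asterisque, §15.5–15.6 (pp. 253–254)] [cite: Tsuji1999, §3 (p. 6)] -/
theorem unitSideIdentityShapeUpToUnit_galFamily_γ₀ (hne : Nonempty (OrientedGenusDatum F θu))
    (h : UnitSideIdentityShapeUpToUnit F θu) : UnitSideIdentityShapeUpToUnit F (F.galFamily F.γ₀ θu) := by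
  obtain ⟨d⟩ := hne
  intro d'
  have h1 := d.unitFactorisationShape_translateDatum (h d)
  rw [OrientedGenusDatum.unitFactorisationShape_iff_exists_unit] at h1 ⊢
  obtain ⟨w, hw⟩ := h1
  refine ⟨w, ?_⟩
  rw [GenusDatum.θ_eq' d'.toGenusDatum d.translateDatum.toGenusDatum, GenusDatum.x_eq d'.toGenusDatum d.translateDatum.toGenusDatum,
    OrientedGenusDatum.Thetam_eq d' d.translateDatum, Subtype.ext (GenusDatum.ξ_eq' d'.toGenusDatum d.translateDatum.toGenusDatum)]
  exact hw

/-- The same along `δ ∈ Δ`. [cite: Kato2004Asterisque, §15.5–15.6 (pp. 253–254)] [cite: Tsuji1999, §2 Lemma 2.1 (pp. 3–4)] -/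
theorem unitSideIdentityShapeUpToUnit_galFamily_torsion (δ : torsionCyclotomicSubgroup 7)
    (hne : Nonempty (OrientedGenusDatum F θu)) (h : UnitSideIdentityShapeUpToUnit F θu) :
    UnitSideIdentityShapeUpToUnit F (F.galFamily (δ : absoluteGaloisGroup ℚ) θu) := by
  obtain ⟨d⟩ := hne
  intro d'
  have h1 := d.unitFactorisationShape_translateTorsionDatum δ (h d)
  rw [OrientedGenusDatum.unitFactorisationShape_iff_exists_unit] at h1 ⊢
  obtain ⟨w, hw⟩ := h1
  refine ⟨w, ?_⟩
  rw [GenusDatum.θ_eq' d'.toGenusDatum (d.translateTorsionDatum δ).toGenusDatum,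
    GenusDatum.x_eq d'.toGenusDatum (d.translateTorsionDatum δ).toGenusDatum,
    OrientedGenusDatum.Thetam_eq d' (d.translateTorsionDatum δ),
    Subtype.ext (GenusDatum.ξ_eq' d'.toGenusDatum (d.translateTorsionDatum δ).toGenusDatum)]
  exact hw

/-! ## §4 The DEAD LETTERS, named (critic idea-crit-15 g14, probe 57a0fc5c83d5df02 §3–§4, re-homed verbatim modulo names):
the EXACT-constant identity «∀ value-pinned `θu`, `∃ u ∈ {±1,±2}`, `θ = (c₀·u·x·Θm)•ξ`» is false modulo ONE pinned datum with
`Θm ≠ 0` and `e_{η₁}ξ` `Λ`-torsion-free — so no seat re-files the finite-constant letter -/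

/-- (W3) Two instances of the exact-constant identity on one `γ₀`-orbit: `(c₀·x·Θm·((1+T)·u − u'))•e_{η₁}ξ = 0` for some
`u, u' ∈ {±1, ±2}` (critic idea-crit-15 g14). [cite: Kato2004Asterisque, §15.5–15.6 (pp. 253–254)] -/
theorem smul_eq_zero_of_shape_pair (d : OrientedGenusDatum F θu) (h : UnitSideIdentityShape F θu)
    (h' : UnitSideIdentityShape F (F.galFamily F.γ₀ θu)) :
    ∃ u u' : ℤ, (u = 1 ∨ u = -1 ∨ u = 2 ∨ u = -2) ∧ (u' = 1 ∨ u' = -1 ∨ u' = 2 ∨ u' = -2) ∧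
      (C GenusDatum.cZero * d.x * d.Θm * ((1 + X) * C ((u : ℤ) : ℤ_[7]) - C ((u' : ℤ) : ℤ_[7]))) •
        ((d.ξ : F.U.chiPart F.η₁) : F.U.M) = 0 := by
  obtain ⟨u, hu, hθ⟩ := h d
  obtain ⟨u', hu', hθ'⟩ := h' d.translateDatum
  refine ⟨u, u', hu, hu', ?_⟩
  rw [OrientedGenusDatum.translateDatum_θ, OrientedGenusDatum.translateDatum_ξ, OrientedGenusDatum.translateDatum_x,
    OrientedGenusDatum.translateDatum_Θm, hθ, ← mul_smul] at hθ'
  have h1 := congrArg (fun t : F.U.chiPart F.η₁ => (t : F.U.M)) hθ'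
  simp only [Submodule.coe_smul] at h1
  rw [show C GenusDatum.cZero * d.x * d.Θm * ((1 + X) * C ((u : ℤ) : ℤ_[7]) - C ((u' : ℤ) : ℤ_[7])) =
      (1 + X) * (C GenusDatum.cZero * C ((u : ℤ) : ℤ_[7]) * d.x * d.Θm) -
        C GenusDatum.cZero * C ((u' : ℤ) : ℤ_[7]) * d.x * d.Θm by ring,
    sub_smul, h1, sub_self]

/-- The residual scalar `(1+T)·u − u'` is non-zero for `u ∈ {±1, ±2}` (its `T`-coefficient is `u`) (critic idea-crit-15 g14).
[cite: Lang1990, Ch. 5 §1 (PDF p. 126)] -/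
theorem scalar_ne_zero {u u' : ℤ} (hu : u = 1 ∨ u = -1 ∨ u = 2 ∨ u = -2) :
    ((1 + X : IwasawaAlgebra 7) * C ((u : ℤ) : ℤ_[7]) - C ((u' : ℤ) : ℤ_[7])) ≠ 0 := by
  intro h
  have h1 := congrArg (PowerSeries.coeff 1) h
  simp only [add_mul, one_mul, map_sub, map_add, PowerSeries.coeff_C, one_ne_zero, if_false,
    PowerSeries.coeff_succ_X_mul, map_zero, zero_add, sub_zero] at h1
  have h2 : (u : ℤ) = 0 := by exact_mod_cast h1
  rcases hu with h | h | h | h <;> omega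

/-- **`x ≠ 0`** from the frame pins alone: `x(0) = N𝔞 − η₁(N𝔞)`, `η₁(N𝔞)⁶ = 1`, `N𝔞 ≥ 2` (critic idea-crit-15 g14).
[cite: Kato2004Asterisque, §15.5 (p. 253, the auxiliary ideal 𝔞)] -/
theorem GenusDatum.x_ne_zero (d : GenusDatum F θu) : d.x ≠ 0 := by
  have hx0 : PowerSeries.constantCoeff d.x = (F.normA : ℤ_[7]) - F.etaOneNormA := by
    have h := d.x_spec 0
    rw [layerModulus_zero, Ideal.mem_span_singleton'] at h
    obtain ⟨a, ha⟩ := h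
    have h' := congrArg PowerSeries.constantCoeff ha
    simp only [map_mul, PowerSeries.constantCoeff_X, mul_zero, map_sub, map_pow, map_add, map_one,
      PowerSeries.constantCoeff_C, add_zero, one_pow, mul_one] at h'
    exact (sub_eq_zero.mp h'.symm)
  have hcopd : F.normA.Coprime F.d := Nat.Coprime.coprime_dvd_right (Dvd.intro_left 7 rfl) F.normA_coprime
  have hcop7 : F.normA.Coprime 7 := Nat.Coprime.coprime_dvd_right (Dvd.intro F.d rfl) F.normA_coprime
  have hunit_d : IsUnit (F.normA : ZMod F.d) := (ZMod.isUnit_iff_coprime _ _).mpr hcopd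
  have hne7 : (F.normA : ZMod 7) ≠ 0 := by
    haveI : Fact (Nat.Prime 7) := ⟨by norm_num⟩
    intro h0
    rw [ZMod.natCast_eq_zero_iff] at h0
    have := Nat.Coprime.eq_one_of_dvd (Nat.Coprime.symm hcop7) h0
    norm_num at this
  have hη6 : F.etaOneNormA ^ 6 = 1 := by
    have hχ : F.χD (F.normA : ZMod F.d) ^ 2 = 1 := by
      rw [sq, ← MulChar.mul_apply, F.χD_mul_self, MulChar.one_apply hunit_d]
    have hχ6 : F.χD (F.normA : ZMod F.d) ^ 6 = 1 := by
      rw [show (6 : ℕ) = 2 * 3 from rfl, pow_mul, hχ, one_pow]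
    have hω : F.ω (F.normA : ZMod 7) ^ 6 = 1 := by
      haveI : Fact (Nat.Prime 7) := ⟨by norm_num⟩
      rw [← map_pow, ZMod.pow_card_sub_one_eq_one hne7, map_one]
    have hω30 : F.ω (F.normA : ZMod 7) ^ (5 * 6) = 1 := by rw [mul_comm, pow_mul, hω, one_pow]
    rw [GenusFrame.etaOneNormA_def, mul_pow, ← pow_mul, hχ6, hω30, one_mul]
  intro hx
  rw [hx, map_zero, eq_comm, sub_eq_zero] at hx0
  have h6 : ((F.normA ^ 6 : ℕ) : ℤ_[7]) = 1 := by rw [Nat.cast_pow, hx0, hη6]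
  have h6' : F.normA ^ 6 = 1 := by exact_mod_cast h6
  have := F.two_le_normA
  rw [pow_eq_one_iff] at h6'
  omega

/-- **(W4) «∀ value-pinned `θu`, the EXACT-constant identity» IS FALSE** as soon as one pinned `(F, θu, d)` exists with
`Θm ≠ 0` and `e_{η₁}ξ` `Λ`-torsion-free (critic idea-crit-15 g14; this is why (5) is re-lettered up to `Λˣ`).
[cite: Kato2004Asterisque, §15.5–15.6 (pp. 253–254)] -/
theorem not_forall_unitSide (hθu : IsNormedEllipticUnitFamily F θu) (d : OrientedGenusDatum F θu) (hΘ : d.Θm ≠ 0)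
    (htf : ∀ f : IwasawaAlgebra 7, f • ((d.ξ : F.U.chiPart F.η₁) : F.U.M) = 0 → f = 0) :
    ¬ ∀ (F : GenusFrame) (θu : ∀ n : ℕ, globalUnitsOf (F.layer n)),
        IsNormedEllipticUnitFamily F θu → UnitSideIdentityShape F θu := by
  intro H
  obtain ⟨u, u', hu, -, h0⟩ :=
    smul_eq_zero_of_shape_pair d (H F θu hθu) (H F _ (isNormedEllipticUnitFamily_galFamily F.γ₀ hθu))
  have h1 := htf _ h0
  have hc : (C GenusDatum.cZero : IwasawaAlgebra 7) ≠ 0 := by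
    intro h
    have := congrArg PowerSeries.constantCoeff h
    rw [PowerSeries.constantCoeff_C, map_zero] at this
    exact GenusDatum.isUnit_cZero.ne_zero this
  exact mul_ne_zero (mul_ne_zero (mul_ne_zero hc d.x_ne_zero) hΘ) (scalar_ne_zero hu) h1

/-- **… hence v11/v12's ORIENTED EXACT letter `stub_genusFactorisationSeven` is false modulo the same** (via the tree's
`residual_of_exists_orientedShape`) (critic idea-crit-15 g14). [cite: Kato2004Asterisque, §15.5–15.6 (pp. 253–254)] -/
theorem not_stub_K1u (hθu : IsNormedEllipticUnitFamily F θu) (d : OrientedGenusDatum F θu) (hΘ : d.Θm ≠ 0)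
    (htf : ∀ f : IwasawaAlgebra 7, f • ((d.ξ : F.U.chiPart F.η₁) : F.U.M) = 0 → f = 0) :
    ¬ ∀ (F : GenusSeven.GenusFrame) (θu : ∀ n : ℕ, globalUnitsOf (F.layer n)),
        GenusSeven.IsNormedEllipticUnitFamily F θu →
          ∃ d : GenusSeven.OrientedGenusDatum F θu, GenusSeven.OrientedGenusFactorisationShape d := by
  intro H
  exact not_forall_unitSide hθu d hΘ htf fun F θu h => (residual_of_exists_orientedShape (H F θu h)).2

/-- **… and so is the REGISTERED v13 INPUT-FORM letter `stub_genusUnitSideInputsSeven`** (`Lines/kato_perrin_riou_zp.lean`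
dc78fcfefa3e951e l.471–481, VERBATIM; its last conjunct is the exact-constant identity) (critic idea-crit-15 g14).
[cite: Kato2004Asterisque, §15.5–15.6 (pp. 253–254)] -/
theorem not_stub_inputs_v13 (hθu : IsNormedEllipticUnitFamily F θu) (d : OrientedGenusDatum F θu) (hΘ : d.Θm ≠ 0)
    (htf : ∀ f : IwasawaAlgebra 7, f • ((d.ξ : F.U.chiPart F.η₁) : F.U.M) = 0 → f = 0) :
    ¬ ∀ (F : GenusSeven.GenusFrame) (θu : ∀ n : ℕ, globalUnitsOf (F.layer n)), GenusSeven.IsNormedEllipticUnitFamily F θu →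
      (F.IsPrincipalPowFamily θu ∧ F.IsNormCoherentPowFamily θu) ∧
        (∀ ξu : ∀ n : ℕ, globalUnitsOf (F.layer n),
          (∀ n : ℕ, (((ξu n : globalUnitsOf (F.layer n)) : (AlgebraicClosure ℚ)ˣ) : AlgebraicClosure ℚ) =
              CyclotomicUnits.sinnottNorm (t := 7 ^ (n + 1) * F.d) (F.layer n) (F.ζsys n) 1) →
            (F.IsPrincipalPowFamily ξu ∧ F.IsNormCoherentPowFamily ξu) ∧ GenusSeven.SinnottSpanShape F ξu) ∧
        GenusSeven.UnitSideIdentityShape F θu := by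
  intro H
  exact not_forall_unitSide hθu d hΘ htf fun F θu h => (H F θu h).2.2

/-- **Whereas the UNIT letter survives the same move**: the two instances at `θu` and `γ₀•θu` are consistent (the second is the
first multiplied by the unit `1 + T`).  Recorded as the implication, for any datum. [cite: Kato2004Asterisque, §15.5–15.6 (pp. 253–254)] -/
theorem unitFactorisationShape_pair_consistent (d : OrientedGenusDatum F θu) (h : d.UnitFactorisationShape) :
    d.UnitFactorisationShape ∧ d.translateDatum.UnitFactorisationShape :=
  ⟨h, d.unitFactorisationShape_translateDatum h⟩

end Orbit

end Summit.BirchSwinnertonDyer.Rank1Residual.Additive.GenusSeven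

end
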